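import Literature.Computability.Complexity.TimeBoundsProofs
import Mathlib.Tactic.DeriveFintype
import HarnessLib

/-!
# Clocked iteration of a polynomial-time machine in Mathlib's TM2 model

Trunk `CplxCore`, toolkit for `TimeBounds.lean` (sibling of `TimeBoundsProofs.lean`, which
provides sequential composition). Main result:

* `Literature.Computability.Complexity.PolyTimeComputable.iterate`: if `F : α → α` is `PolyTimeComputable ea ea F`
  for an encoding `ea : α → List A` over a nonempty alphabet `A`, and the encoded iterates grow
  at most linearly, `|ea (F^[n] a)| ≤ d (|ea a| + n)` (e.g. `|ea (F a)| ≤ |ea a| + d`,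
  `PolyTimeComputable.iterate_of_le_add`), then the **clocked iteration**
  `(a, n) ↦ F^[n] a` is `PolyTimeComputable` on the input word
  `List.replicate n none ++ (ea a).map some` over `Option A` (the iteration count `n` in
  unary followed by the encoding of `a`), with output encoding `ea`.

This is the "time counter" device by which a universal machine is clocked (Arora–Barak 2009,
§1.4.1, "Universal TM with time bound": "by adding a time counter to `U` … the time counter is
used to keep track of the number of steps that the computation has taken so far"), isolated as
a machine combinator: it is step (I) of the decomposition of
`Literature.Computability.MetaComplexity.UniversalMachine.clockedUniversalSimulation` (a clocked universal machine is
`output ∘ step^[t] ∘ init` for a polynomial-time one-step function on encoded configurations).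
Nothing of this is in Mathlib, whose only timed TM2 machine is the identity
(`Turing.idComputableInPolyTime`).

## The loop machine (`TM2Iter.iterTM`)

Given a bundled `M : Turing.FinTM2` with identifications `eIn : M.Γ M.k₀ ≃ A`,
`eOut : M.Γ M.k₁ ≃ A`, the loop machine has stacks `M.K ⊕ Aux` with three auxiliary stacks
`IN` (its input stack, alphabet `Option A`), `TMP` (alphabet `A`), `CNT` (alphabet `Unit`),
labels `M.Λ ⊕ Ctrl` with six control labels, and states `M.σ × Option (Option A)` (a register
carrying one popped symbol inside a step; reset between steps). Its output stack is `inl k₁`.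
Control flow (`TM2Iter.ctrlStmt`):

* `init1`: pop `IN` until empty; data symbols `some γ` go to `TMP`, counter units `none` go
  to `CNT`; then `init2`: pour `TMP` onto `k₁` (two reversals restore the order). Invariant at
  `test`: the current value sits, in order, on `k₁`; all other stacks are empty except `CNT`.
* `test`: pop `CNT`; if empty go to `fin` (reset the state, `halt` — this is exactly Mathlib's
  `haltList` convention); otherwise `mv1`: pour `k₁` onto `TMP`, `mv2`: pour `TMP` onto `k₀`,
  and jump to `M.main`. The statements of `M` are translated to act on the first state
  component (`TM2Iter.trStmt`), `halt` becoming `goto test`; since `M` halts in `haltList` form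
  (output on `k₁`, other stacks empty, state reset), the invariant is restored.

## Proof architecture

1. `ReachesIn f a b m` (`∃ n ≤ m`, `n` iterations of `flip bind f` map `some a` to `some b`),
   with `trans`/`mono`; runs of `M` transport to the loop machine (`run_cfgM`, via
   `TM2Comp.iterate_bind_map` and the exact one-statement simulation `stepAux_trStmt`).
2. Stack bookkeeping through `mkStk` (stacks of `M` plus the three auxiliary lists) and its
   `Function.update` lemmas; one-step lemmas for each control label (`step_init1_some`, …),
   obtained by `simp` from the unbundled step equations `step_inr`/`step_inl`.
3. Phase lemmas by induction on the moved list (`init1_data`, `init1_cnt`, `init2_run`,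
   `mv1_run`, `mv2_run`), one iteration (`iterate_once`: `2|x| + 3 + m` steps), the main loop
   (`loop_run`: `c · (2B + 3 + p B) + 2` steps if all iterates have length `≤ B`, using
   monotonicity of `ℕ`-polynomial evaluation), and the initial phase; total
   `≤ (iterPoly p d).eval (|ea a| + n)` with `iterPoly p d = 2X + 4 + X·(2d X + 3 + p∘(d X))`.

## References

* S. Arora, B. Barak, *Computational Complexity: A Modern Approach*, CUP 2009, §1.4.1
  (universal TM with time bound), §1.3 (machine constructions). doi:10.1017/cbo9780511804090
* Mathlib, `Mathlib/Computability/TuringMachine/Computable.lean` (`FinTM2`, `initList`,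
  `haltList`, `TM2OutputsInTime`).
-/

namespace Literature.Computability.Complexity

namespace TM2Iter

open Turing StateTransition Function TM2Comp

/-! ### Reaching a configuration within a number of steps -/

section ReachesIn

variable {C : Type*}

/-- `ReachesIn f a b m`: iterating the partial step function `f` from `a` reaches `b` after some
number `n ≤ m` of steps (all intermediate steps defined). [folklore] -/
def ReachesIn (f : C → Option C) (a b : C) (m : ℕ) : Prop :=
  ∃ n ≤ m, (flip bind f)^[n] (some a) = some b

/-- Zero steps. [folklore] -/
theorem ReachesIn.refl (f : C → Option C) (a : C) : ReachesIn f a a 0 :=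
  ⟨0, le_rfl, rfl⟩

/-- One defined step. [folklore] -/
theorem ReachesIn.single {f : C → Option C} {a b : C} (h : f a = some b) : ReachesIn f a b 1 :=
  ⟨1, le_rfl, by rw [iterate_bind_succ, h]; rfl⟩

/-- Concatenation of bounded runs (bounds add). [folklore] -/
theorem ReachesIn.trans {f : C → Option C} {a b c : C} {m₁ m₂ : ℕ} (h₁ : ReachesIn f a b m₁)
    (h₂ : ReachesIn f b c m₂) : ReachesIn f a c (m₁ + m₂) := by
  obtain ⟨n₁, hn₁, e₁⟩ := h₁
  obtain ⟨n₂, hn₂, e₂⟩ := h₂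
  refine ⟨n₂ + n₁, by omega, ?_⟩
  rw [iterate_add_apply, e₁, e₂]

/-- Weakening the bound. [folklore] -/
theorem ReachesIn.mono {f : C → Option C} {a b : C} {m m' : ℕ} (h : ReachesIn f a b m)
    (hm : m ≤ m') : ReachesIn f a b m' := by
  obtain ⟨n, hn, e⟩ := h
  exact ⟨n, hn.trans hm, e⟩

/-- One step followed by a bounded run. [folklore] -/
theorem ReachesIn.step_trans {f : C → Option C} {a b c : C} {m : ℕ} (h₁ : f a = some b)
    (h₂ : ReachesIn f b c m) : ReachesIn f a c (m + 1) := by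
  have := (ReachesIn.single h₁).trans h₂
  rwa [Nat.add_comm] at this

end ReachesIn

/-! ### The loop machine: auxiliary stacks, control labels, alphabets -/

/-- The three auxiliary stacks of the loop machine: the input stack `IN` (alphabet
`Option A`: `some γ` = data symbol, `none` = one unit of the iteration counter), the transfer
stack `TMP` (alphabet `A`) and the counter stack `CNT` (alphabet `Unit`). [folklore] -/
inductive Aux
  | IN
  | TMP
  | CNT
  deriving DecidableEq, Fintype

/-- The control labels of the loop machine (besides the labels of the iterated machine).
[folklore] -/
inductive Ctrl
  | init1
  | init2
  | test
  | mv1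
  | mv2
  | fin
  deriving DecidableEq, Fintype

section Machine

variable {K : Type} {G : K → Type} {Λ σ A : Type}

/-- Stack alphabets of the loop machine: those of the iterated machine on `inl`, and
`Option A`, `A`, `Unit` on the auxiliary stacks `IN`, `TMP`, `CNT`. Written with `casesOn` so
that it unfolds by `rfl` on constructors. [folklore] -/
abbrev IterΓ (G : K → Type) (A : Type) : K ⊕ Aux → Type := fun j =>
  Sum.casesOn (motive := fun _ => Type) j G
    (fun a => Aux.casesOn (motive := fun _ => Type) a (Option A) A Unit)

/-- Internal states of the loop machine: a state of the iterated machine together with a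
register holding the last popped symbol (`none` between steps). [folklore] -/
abbrev St (σ A : Type) : Type := σ × Option (Option A)

/-- Extract a data symbol from the register (junk value `default` otherwise). [folklore] -/
def iget [Inhabited A] : Option (Option A) → A
  | some (some s) => s
  | _ => default

/-- Is the register holding a counter unit (`some none`)? [folklore] -/
def isCnt : Option (Option A) → Bool
  | some none => true
  | _ => false

/-- Reset the register. [folklore] -/
def rst : St σ A → St σ A := fun v => (v.1, none)

/-- Stack contents of the loop machine from the stacks `S` of the iterated machine and the
contents `i`, `t`, `c` of `IN`, `TMP`, `CNT`. [folklore] -/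
def mkStk (S : ∀ k, List (G k)) (i : List (Option A)) (t : List A) (c : List Unit) :
    ∀ j : K ⊕ Aux, List (IterΓ G A j)
  | Sum.inl k => S k
  | Sum.inr Aux.IN => i
  | Sum.inr Aux.TMP => t
  | Sum.inr Aux.CNT => c

section StkLemmas

variable (S : ∀ k, List (G k)) (i : List (Option A)) (t : List A) (c : List Unit)

/-- Reading a stack of the iterated machine. [folklore] -/
@[simp] theorem mkStk_inl (k : K) : mkStk S i t c (Sum.inl k) = S k := rfl
/-- Reading `IN`. [folklore] -/
@[simp] theorem mkStk_IN : mkStk S i t c (Sum.inr Aux.IN) = i := rfl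
/-- Reading `TMP`. [folklore] -/
@[simp] theorem mkStk_TMP : mkStk S i t c (Sum.inr Aux.TMP) = t := rfl
/-- Reading `CNT`. [folklore] -/
@[simp] theorem mkStk_CNT : mkStk S i t c (Sum.inr Aux.CNT) = c := rfl

variable {dKA : DecidableEq (K ⊕ Aux)}

/-- Writing a stack of the iterated machine (any decidability instance on `K ⊕ Aux`, so that
the lemma also fires on the instance bundled in a `FinTM2`). [folklore] -/
@[simp] theorem mkStk_update_inl [DecidableEq K] (k : K) (L : List (G k)) :
    @update _ _ dKA (mkStk S i t c) (Sum.inl k) L = mkStk (update S k L) i t c := by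
  funext j
  rcases j with k' | a
  · rcases eq_or_ne k' k with rfl | h
    · simp
    · rw [update_of_ne (by simpa using h)]; simp [update_of_ne h]
  · rw [update_of_ne (by simp)]; cases a <;> rfl

/-- Writing `IN`. [folklore] -/
@[simp] theorem mkStk_update_IN (i' : List (Option A)) :
    @update _ _ dKA (mkStk S i t c) (Sum.inr Aux.IN) i' = mkStk S i' t c := by
  funext j
  rcases j with k' | a
  · rw [update_of_ne (by simp)]; rfl
  · cases a
    · simp
    · rw [update_of_ne (by simp)]; rfl
    · rw [update_of_ne (by simp)]; rfl

/-- Writing `TMP`. [folklore] -/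
@[simp] theorem mkStk_update_TMP (t' : List A) :
    @update _ _ dKA (mkStk S i t c) (Sum.inr Aux.TMP) t' = mkStk S i t' c := by
  funext j
  rcases j with k' | a
  · rw [update_of_ne (by simp)]; rfl
  · cases a
    · rw [update_of_ne (by simp)]; rfl
    · simp
    · rw [update_of_ne (by simp)]; rfl

/-- Writing `CNT`. [folklore] -/
@[simp] theorem mkStk_update_CNT (c' : List Unit) :
    @update _ _ dKA (mkStk S i t c) (Sum.inr Aux.CNT) c' = mkStk S i t c' := by
  funext j
  rcases j with k' | a
  · rw [update_of_ne (by simp)]; rfl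
  · cases a
    · rw [update_of_ne (by simp)]; rfl
    · rw [update_of_ne (by simp)]; rfl
    · simp

/-- The empty stack assignment. [folklore] -/
theorem mkStk_bot :
    mkStk (A := A) (fun k => ([] : List (G k))) [] [] [] = fun j => ([] : List (IterΓ G A j)) := by
  funext j
  rcases j with k | a
  · rfl
  · cases a <;> rfl

/-- The initial stack assignment of the loop machine (input word on `IN`). [folklore] -/
theorem mkStk_bot_IN [DecidableEq K] (l : List (Option A)) :
    mkStk (fun k => ([] : List (G k))) l [] [] = update (fun j => ([] : List (IterΓ G A j)))
      (Sum.inr Aux.IN) l := by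
  rw [← mkStk_bot, mkStk_update_IN]

/-- A single-stack assignment of the iterated machine, embedded. [folklore] -/
theorem mkStk_bot_inl [DecidableEq K] (k : K) (L : List (G k)) :
    mkStk (A := A) (update (fun k => ([] : List (G k))) k L) [] [] [] =
      update (fun j => ([] : List (IterΓ G A j))) (Sum.inl k) L := by
  rw [← mkStk_bot, mkStk_update_inl]

end StkLemmas

/-- Translation of the statements of the iterated machine: act on the `inl` stacks and the
first state component; `halt` becomes a jump to the control label `test`. [folklore] -/
def trStmt : TM2.Stmt G Λ σ → TM2.Stmt (IterΓ G A) (Λ ⊕ Ctrl) (St σ A)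
  | TM2.Stmt.push k f q => TM2.Stmt.push (Sum.inl k) (fun s => f s.1) (trStmt q)
  | TM2.Stmt.peek k f q => TM2.Stmt.peek (Sum.inl k) (fun s x => (f s.1 x, s.2)) (trStmt q)
  | TM2.Stmt.pop k f q => TM2.Stmt.pop (Sum.inl k) (fun s x => (f s.1 x, s.2)) (trStmt q)
  | TM2.Stmt.load f q => TM2.Stmt.load (fun s => (f s.1, s.2)) (trStmt q)
  | TM2.Stmt.branch p q₁ q₂ => TM2.Stmt.branch (fun s => p s.1) (trStmt q₁) (trStmt q₂)
  | TM2.Stmt.goto l => TM2.Stmt.goto fun s => Sum.inl (l s.1)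
  | TM2.Stmt.halt => TM2.Stmt.goto fun _ => Sum.inr Ctrl.test

/-- Configuration of the loop machine while the iterated machine runs (auxiliary stacks empty
except the counter `cnt`; the halting label is sent to `test`). [folklore] -/
def cfgM (c : TM2.Cfg G Λ σ) (cnt : List Unit) : TM2.Cfg (IterΓ G A) (Λ ⊕ Ctrl) (St σ A) :=
  ⟨some (c.l.elim (Sum.inr Ctrl.test) Sum.inl), (c.var, none), mkStk c.stk [] [] cnt⟩

/-- One statement of the iterated machine is simulated exactly by its translation. [folklore] -/
theorem stepAux_trStmt [DecidableEq K] (q : TM2.Stmt G Λ σ) (v : σ) (S : ∀ k, List (G k))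
    (cnt : List Unit) :
    TM2.stepAux (trStmt (A := A) q) (v, none) (mkStk S [] [] cnt) =
      cfgM (TM2.stepAux q v S) cnt := by
  induction q generalizing v S with
  | push k f q ih =>
    simp only [trStmt, TM2.stepAux]
    rw [← ih, mkStk_inl, mkStk_update_inl]
  | peek k f q ih => simp only [trStmt, TM2.stepAux]; exact ih _ _
  | pop k f q ih =>
    simp only [trStmt, TM2.stepAux]
    rw [← ih, mkStk_inl, mkStk_update_inl]
  | load f q ih => simp only [trStmt, TM2.stepAux]; exact ih _ _
  | branch p q₁ q₂ ih₁ ih₂ =>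
    simp only [trStmt, TM2.stepAux]
    cases p v
    · exact ih₂ _ _
    · exact ih₁ _ _
  | goto l => rfl
  | halt => rfl

variable [Inhabited A] (k₀ k₁ : K) (eIn : G k₀ ≃ A) (eOut : G k₁ ≃ A) (main : Λ) (init : σ)

/-- The control statements of the loop machine.
* `init1`: distribute the input stack `IN`: data symbols to `TMP`, counter units to `CNT`;
* `init2`: move `TMP` onto the output stack `k₁` of the iterated machine (restoring the order);
* `test`: if the counter is exhausted, finish; otherwise consume one unit and
* `mv1`, `mv2`: move the current value from `k₁` via `TMP` to the input stack `k₀`, then start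
  the iterated machine at `main`;
* `fin`: reset the state and halt.
Every control statement resets the symbol register before jumping. [folklore] -/
def ctrlStmt : Ctrl → TM2.Stmt (IterΓ G A) (Λ ⊕ Ctrl) (St σ A)
  | Ctrl.init1 =>
      TM2.Stmt.pop (Sum.inr Aux.IN) (fun v a => (v.1, a)) <|
        TM2.Stmt.branch (fun v => v.2.isNone)
          (TM2.Stmt.load rst <| TM2.Stmt.goto fun _ => Sum.inr Ctrl.init2) <|
          TM2.Stmt.branch (fun v => isCnt v.2)
            (TM2.Stmt.push (Sum.inr Aux.CNT) (fun _ => ()) <| TM2.Stmt.load rst <|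
              TM2.Stmt.goto fun _ => Sum.inr Ctrl.init1)
            (TM2.Stmt.push (Sum.inr Aux.TMP) (fun v => iget v.2) <| TM2.Stmt.load rst <|
              TM2.Stmt.goto fun _ => Sum.inr Ctrl.init1)
  | Ctrl.init2 =>
      TM2.Stmt.pop (Sum.inr Aux.TMP) (fun v a => (v.1, a.map some)) <|
        TM2.Stmt.branch (fun v => v.2.isNone)
          (TM2.Stmt.load rst <| TM2.Stmt.goto fun _ => Sum.inr Ctrl.test)
          (TM2.Stmt.push (Sum.inl k₁) (fun v => eOut.symm (iget v.2)) <| TM2.Stmt.load rst <|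
            TM2.Stmt.goto fun _ => Sum.inr Ctrl.init2)
  | Ctrl.test =>
      TM2.Stmt.pop (Sum.inr Aux.CNT) (fun v a => (v.1, a.map fun _ => none)) <|
        TM2.Stmt.branch (fun v => v.2.isNone)
          (TM2.Stmt.load rst <| TM2.Stmt.goto fun _ => Sum.inr Ctrl.fin)
          (TM2.Stmt.load rst <| TM2.Stmt.goto fun _ => Sum.inr Ctrl.mv1)
  | Ctrl.mv1 =>
      TM2.Stmt.pop (Sum.inl k₁) (fun v a => (v.1, a.map fun g => some (eOut g))) <|
        TM2.Stmt.branch (fun v => v.2.isNone)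
          (TM2.Stmt.load rst <| TM2.Stmt.goto fun _ => Sum.inr Ctrl.mv2)
          (TM2.Stmt.push (Sum.inr Aux.TMP) (fun v => iget v.2) <| TM2.Stmt.load rst <|
            TM2.Stmt.goto fun _ => Sum.inr Ctrl.mv1)
  | Ctrl.mv2 =>
      TM2.Stmt.pop (Sum.inr Aux.TMP) (fun v a => (v.1, a.map some)) <|
        TM2.Stmt.branch (fun v => v.2.isNone)
          (TM2.Stmt.load rst <| TM2.Stmt.goto fun _ => Sum.inl main)
          (TM2.Stmt.push (Sum.inl k₀) (fun v => eIn.symm (iget v.2)) <| TM2.Stmt.load rst <|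
            TM2.Stmt.goto fun _ => Sum.inr Ctrl.mv2)
  | Ctrl.fin => TM2.Stmt.load (fun _ => (init, none)) TM2.Stmt.halt

end Machine

/-! ### Bundling: the loop machine as a `FinTM2` -/

section Bundled

variable (M : FinTM2) (A : Type)

/-- Configurations of the loop machine with a reset symbol register, from the label, the
`M`-state, the stacks of `M` and the three auxiliary stacks. [folklore] -/
def cfg (l : Option (M.Λ ⊕ Ctrl)) (v : M.σ) (S : ∀ k, List (M.Γ k)) (i : List (Option A))
    (t : List A) (c : List Unit) : TM2.Cfg (IterΓ M.Γ A) (M.Λ ⊕ Ctrl) (St M.σ A) :=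
  ⟨l, (v, none), mkStk S i t c⟩

/-- The (unbundled) type of configurations of the loop machine. [folklore] -/
abbrev LCfg : Type := TM2.Cfg (IterΓ M.Γ A) (M.Λ ⊕ Ctrl) (St M.σ A)

variable {A} [Inhabited A] (eIn : M.Γ M.k₀ ≃ A) (eOut : M.Γ M.k₁ ≃ A)

/-- The loop machine of a bundled TM2 machine `M` whose input and output alphabets are
identified with `A`: stacks `M.K ⊕ Aux` (input stack `inr IN` over `Option A`, output stack
`inl k₁`), labels `M.Λ ⊕ Ctrl` (main label `init1`), states `M.σ × Option (Option A)`.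
On input `List.replicate n none ++ x.map some` it runs `M` `n` times, feeding each output back
as the next input. [cite: AroraBarak2009, §1.4.1 (universal TM with time bound: step counter)] -/
noncomputable def iterTM : FinTM2 :=
  letI := M.kFin; letI := M.ΛFin; letI := M.σFin; letI := M.Γk₀Fin
  letI : Fintype A := Fintype.ofEquiv _ eIn
  { K := M.K ⊕ Aux
    k₀ := Sum.inr Aux.IN
    k₁ := Sum.inl M.k₁
    Γ := IterΓ M.Γ A
    Λ := M.Λ ⊕ Ctrl
    main := Sum.inr Ctrl.init1
    σ := St M.σ A
    initialState := (M.initialState, none)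
    Γk₀Fin := (inferInstance : Fintype (Option A))
    m := fun l => match l with
      | Sum.inl l => trStmt (M.m l)
      | Sum.inr c => ctrlStmt M.k₀ M.k₁ eIn eOut M.main M.initialState c }

/-- A step of the loop machine at a control label, unbundled. [folklore] -/
theorem step_inr (c : Ctrl) (var : St M.σ A) (stk : ∀ j, List (IterΓ M.Γ A j)) :
    (iterTM M eIn eOut).step
        (⟨some (Sum.inr c), var, stk⟩ : TM2.Cfg (IterΓ M.Γ A) (M.Λ ⊕ Ctrl) (St M.σ A)) =
      some (TM2.stepAux (ctrlStmt M.k₀ M.k₁ eIn eOut M.main M.initialState c) var stk) :=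
  rfl

/-- A step of the loop machine at a label of the iterated machine, unbundled. [folklore] -/
theorem step_inl (l : M.Λ) (var : St M.σ A) (stk : ∀ j, List (IterΓ M.Γ A j)) :
    (iterTM M eIn eOut).step
        (⟨some (Sum.inl l), var, stk⟩ : TM2.Cfg (IterΓ M.Γ A) (M.Λ ⊕ Ctrl) (St M.σ A)) =
      some (TM2.stepAux (trStmt (M.m l)) var stk) :=
  rfl

/-! ### Single steps of the control labels -/

section Steps

variable (v : M.σ) (S : ∀ k, List (M.Γ k)) (i : List (Option A)) (t : List A) (c : List Unit)

/-- `init1` on a data symbol: move it to `TMP`. [folklore] -/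
theorem step_init1_some (s : A) :
    (iterTM M eIn eOut).step (cfg M A (some (Sum.inr Ctrl.init1)) v S (some s :: i) t c) =
      some (cfg M A (some (Sum.inr Ctrl.init1)) v S i (s :: t) c) := by
  rw [cfg, step_inr]; simp [ctrlStmt, rst, iget, isCnt, cfg]

/-- `init1` on a counter unit: move it to `CNT`. [folklore] -/
theorem step_init1_none :
    (iterTM M eIn eOut).step (cfg M A (some (Sum.inr Ctrl.init1)) v S (none :: i) t c) =
      some (cfg M A (some (Sum.inr Ctrl.init1)) v S i t (() :: c)) := by
  rw [cfg, step_inr]; simp [ctrlStmt, rst, isCnt, cfg]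

/-- `init1` on empty `IN`: proceed to `init2`. [folklore] -/
theorem step_init1_nil :
    (iterTM M eIn eOut).step (cfg M A (some (Sum.inr Ctrl.init1)) v S [] t c) =
      some (cfg M A (some (Sum.inr Ctrl.init2)) v S [] t c) := by
  rw [cfg, step_inr]; simp [ctrlStmt, rst, cfg]

/-- `init2` on nonempty `TMP`: move one symbol to `k₁` (through `eOut.symm`). [folklore] -/
theorem step_init2_cons (s : A) :
    (iterTM M eIn eOut).step (cfg M A (some (Sum.inr Ctrl.init2)) v S i (s :: t) c) =
      some (cfg M A (some (Sum.inr Ctrl.init2)) v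
        (update S M.k₁ (eOut.symm s :: S M.k₁)) i t c) := by
  rw [cfg, step_inr]; simp [ctrlStmt, rst, iget, cfg]

/-- `init2` on empty `TMP`: proceed to `test`. [folklore] -/
theorem step_init2_nil :
    (iterTM M eIn eOut).step (cfg M A (some (Sum.inr Ctrl.init2)) v S i [] c) =
      some (cfg M A (some (Sum.inr Ctrl.test)) v S i [] c) := by
  rw [cfg, step_inr]; simp [ctrlStmt, rst, cfg]

/-- `test` with a counter unit left: consume it and proceed to `mv1`. [folklore] -/
theorem step_test_cons (u : Unit) :
    (iterTM M eIn eOut).step (cfg M A (some (Sum.inr Ctrl.test)) v S i t (u :: c)) =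
      some (cfg M A (some (Sum.inr Ctrl.mv1)) v S i t c) := by
  rw [cfg, step_inr]; simp [ctrlStmt, rst, cfg]

/-- `test` with the counter exhausted: proceed to `fin`. [folklore] -/
theorem step_test_nil :
    (iterTM M eIn eOut).step (cfg M A (some (Sum.inr Ctrl.test)) v S i t []) =
      some (cfg M A (some (Sum.inr Ctrl.fin)) v S i t []) := by
  rw [cfg, step_inr]; simp [ctrlStmt, rst, cfg]

/-- `mv1` on nonempty `k₁`: move one symbol to `TMP` (through `eOut`). [folklore] -/
theorem step_mv1_cons (g : M.Γ M.k₁) (L : List (M.Γ M.k₁)) :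
    (iterTM M eIn eOut).step
        (cfg M A (some (Sum.inr Ctrl.mv1)) v (update S M.k₁ (g :: L)) i t c) =
      some (cfg M A (some (Sum.inr Ctrl.mv1)) v (update S M.k₁ L) i (eOut g :: t) c) := by
  rw [cfg, step_inr]; simp [ctrlStmt, rst, iget, cfg]

/-- `mv1` on empty `k₁`: proceed to `mv2`. [folklore] -/
theorem step_mv1_nil :
    (iterTM M eIn eOut).step (cfg M A (some (Sum.inr Ctrl.mv1)) v (update S M.k₁ []) i t c) =
      some (cfg M A (some (Sum.inr Ctrl.mv2)) v (update S M.k₁ []) i t c) := by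
  rw [cfg, step_inr]; simp [ctrlStmt, rst, cfg]

/-- `mv2` on nonempty `TMP`: move one symbol to `k₀` (through `eIn.symm`). [folklore] -/
theorem step_mv2_cons (s : A) :
    (iterTM M eIn eOut).step (cfg M A (some (Sum.inr Ctrl.mv2)) v S i (s :: t) c) =
      some (cfg M A (some (Sum.inr Ctrl.mv2)) v
        (update S M.k₀ (eIn.symm s :: S M.k₀)) i t c) := by
  rw [cfg, step_inr]; simp [ctrlStmt, rst, iget, cfg]

/-- `mv2` on empty `TMP`: jump to the main label of `M`. [folklore] -/
theorem step_mv2_nil :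
    (iterTM M eIn eOut).step (cfg M A (some (Sum.inr Ctrl.mv2)) v S i [] c) =
      some (cfg M A (some (Sum.inl M.main)) v S i [] c) := by
  rw [cfg, step_inr]; simp [ctrlStmt, rst, cfg]

/-- `fin`: reset the state and halt. [folklore] -/
theorem step_fin :
    (iterTM M eIn eOut).step (cfg M A (some (Sum.inr Ctrl.fin)) v S i t c) =
      some (cfg M A none M.initialState S i t c) := by
  rw [cfg, step_inr]; simp [ctrlStmt, cfg]

/-- A step of the iterated machine `M` is a step of the loop machine on the embedded
configuration. [folklore] -/
theorem step_cfgM (a b : M.Cfg) (h : M.step a = some b) (cnt : List Unit) :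
    (iterTM M eIn eOut).step (cfgM (A := A) a cnt) = some (cfgM b cnt) := by
  obtain ⟨_ | l, w, S'⟩ := a
  · simp [FinTM2.step, TM2.step] at h
  · simp only [FinTM2.step, TM2.step] at h
    obtain rfl := Option.some.inj h
    simp only [cfgM, Option.elim]
    rw [step_inl, stepAux_trStmt]
    rfl

end Steps

/-! ### Phases of the loop machine -/

section Phases

variable (v : M.σ) (S : ∀ k, List (M.Γ k))

/-- `init1`, data part: the data symbols of the input are moved (reversed) onto `TMP`.
[folklore] -/
theorem init1_data (xs : List A) (rest : List (Option A)) (t : List A) (c : List Unit) :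
    ReachesIn (C := LCfg M A) (iterTM M eIn eOut).step
      (cfg M A (some (Sum.inr Ctrl.init1)) v S (xs.map some ++ rest) t c)
      (cfg M A (some (Sum.inr Ctrl.init1)) v S rest (xs.reverse ++ t) c) xs.length := by
  induction xs generalizing t with
  | nil => simpa using ReachesIn.refl _ _
  | cons x xs ih =>
    simpa [List.append_assoc] using
      ReachesIn.step_trans (step_init1_some M eIn eOut v S (xs.map some ++ rest) t c x)
        (ih (x :: t))

/-- `init1`, counter part: the counter units at the head of the input are moved onto `CNT`.
[folklore] -/
theorem init1_cnt (n : ℕ) (rest : List (Option A)) (t : List A) (c : List Unit) :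
    ReachesIn (C := LCfg M A) (iterTM M eIn eOut).step
      (cfg M A (some (Sum.inr Ctrl.init1)) v S (List.replicate n none ++ rest) t c)
      (cfg M A (some (Sum.inr Ctrl.init1)) v S rest t (List.replicate n () ++ c)) n := by
  induction n generalizing c with
  | zero => simpa using ReachesIn.refl _ _
  | succ n ih =>
    have h : List.replicate (n + 1) () ++ c = List.replicate n () ++ (() :: c) := by
      rw [List.replicate_succ', List.append_assoc, List.singleton_append]
    rw [h, List.replicate_succ, List.cons_append]
    exact ReachesIn.step_trans (step_init1_none M eIn eOut v S _ t c) (ih (() :: c))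

/-- `init2`: `TMP` is moved (reversed) on top of the output stack `k₁` of `M`, then the machine
proceeds to `test`. [folklore] -/
theorem init2_run (i : List (Option A)) (t : List A) (c : List Unit) :
    ReachesIn (C := LCfg M A) (iterTM M eIn eOut).step
      (cfg M A (some (Sum.inr Ctrl.init2)) v S i t c)
      (cfg M A (some (Sum.inr Ctrl.test)) v (update S M.k₁ (t.reverse.map eOut.symm ++ S M.k₁)) i [] c)
      (t.length + 1) := by
  induction t generalizing S with
  | nil =>
    simpa using ReachesIn.single (step_init2_nil M eIn eOut v S i c)
  | cons s t ih =>
    have := ih (update S M.k₁ (eOut.symm s :: S M.k₁))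
    rw [update_idem, update_self] at this
    simpa [List.append_assoc] using
      ReachesIn.step_trans (step_init2_cons M eIn eOut v S i t c s) this

/-- `mv1`: the output stack `k₁` of `M` is moved (reversed, read through `eOut`) onto `TMP`,
then the machine proceeds to `mv2`. [folklore] -/
theorem mv1_run (L : List (M.Γ M.k₁)) (i : List (Option A)) (t : List A) (c : List Unit) :
    ReachesIn (C := LCfg M A) (iterTM M eIn eOut).step
      (cfg M A (some (Sum.inr Ctrl.mv1)) v (update S M.k₁ L) i t c)
      (cfg M A (some (Sum.inr Ctrl.mv2)) v (update S M.k₁ []) i (L.reverse.map eOut ++ t) c)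
      (L.length + 1) := by
  induction L generalizing t with
  | nil => simpa using ReachesIn.single (step_mv1_nil M eIn eOut v S i t c)
  | cons g L ih =>
    simpa [List.append_assoc] using
      ReachesIn.step_trans (step_mv1_cons M eIn eOut v S i t c g L) (ih (eOut g :: t))

/-- `mv2`: `TMP` is moved (reversed, written through `eIn`) on top of the input stack `k₀` of
`M`, then the machine jumps to the main label of `M`. [folklore] -/
theorem mv2_run (i : List (Option A)) (t : List A) (c : List Unit) :
    ReachesIn (C := LCfg M A) (iterTM M eIn eOut).step
      (cfg M A (some (Sum.inr Ctrl.mv2)) v S i t c)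
      (cfg M A (some (Sum.inl M.main)) v (update S M.k₀ (t.reverse.map eIn.symm ++ S M.k₀)) i [] c)
      (t.length + 1) := by
  induction t generalizing S with
  | nil =>
    simpa using ReachesIn.single (step_mv2_nil M eIn eOut v S i c)
  | cons s t ih =>
    have := ih (update S M.k₀ (eIn.symm s :: S M.k₀))
    rw [update_idem, update_self] at this
    simpa [List.append_assoc] using
      ReachesIn.step_trans (step_mv2_cons M eIn eOut v S i t c s) this

/-- A run of the iterated machine `M` is a run of the loop machine on embedded configurations.
[folklore] -/
theorem run_cfgM {n : ℕ} {a b : M.Cfg} (h : (flip bind M.step)^[n] (some a) = some b)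
    (cnt : List Unit) :
    (flip bind (iterTM M eIn eOut).step)^[n] (some (cfgM (A := A) a cnt)) = some (cfgM b cnt) :=
  iterate_bind_map M.step (iterTM M eIn eOut).step (fun x => cfgM x cnt)
    (fun x y hxy => step_cfgM M eIn eOut x y hxy cnt) n a b h

/-- The initial configuration of the loop machine. [folklore] -/
theorem initList_iterTM (l : List (Option A)) :
    initList (iterTM M eIn eOut) l =
      cfg M A (some (Sum.inr Ctrl.init1)) M.initialState (fun _ => []) l [] [] := by
  rw [initList_eq]
  change (⟨some (Sum.inr Ctrl.init1), (M.initialState, none),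
      update (fun j => ([] : List (IterΓ M.Γ A j))) (Sum.inr Aux.IN) l⟩ :
      TM2.Cfg (IterΓ M.Γ A) (M.Λ ⊕ Ctrl) (St M.σ A)) = _
  rw [← mkStk_bot_IN]
  rfl

/-- The halting configuration of the loop machine. [folklore] -/
theorem haltList_iterTM (L : List (M.Γ M.k₁)) :
    haltList (iterTM M eIn eOut) L =
      cfg M A none M.initialState (update (fun _ => []) M.k₁ L) [] [] [] := by
  rw [haltList_eq]
  change (⟨none, (M.initialState, none),
      update (fun j => ([] : List (IterΓ M.Γ A j))) (Sum.inl M.k₁) L⟩ :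
      TM2.Cfg (IterΓ M.Γ A) (M.Λ ⊕ Ctrl) (St M.σ A)) = _
  rw [← mkStk_bot_inl]
  rfl

omit [Inhabited A] in
/-- The embedded initial configuration of `M` on input `l`, with counter `cnt`. [folklore] -/
theorem cfgM_initList (l : List (M.Γ M.k₀)) (cnt : List Unit) :
    cfgM (A := A) (initList M l) cnt =
      cfg M A (some (Sum.inl M.main)) M.initialState (update (fun _ => []) M.k₀ l) [] [] cnt := by
  rw [initList_eq]; rfl

omit [Inhabited A] in
/-- The embedded halting configuration of `M` with output `L`, with counter `cnt`: the loop
machine is back at `test`. [folklore] -/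
theorem cfgM_haltList (L : List (M.Γ M.k₁)) (cnt : List Unit) :
    cfgM (A := A) (haltList M L) cnt =
      cfg M A (some (Sum.inr Ctrl.test)) M.initialState (update (fun _ => []) M.k₁ L) [] [] cnt := by
  rw [haltList_eq]; rfl

/-- The configuration of the loop machine at `test`: current value `x` on the output stack of
`M`, `n` counter units left. [folklore] -/
def cfgT (x : List A) (n : ℕ) : TM2.Cfg (IterΓ M.Γ A) (M.Λ ⊕ Ctrl) (St M.σ A) :=
  cfg M A (some (Sum.inr Ctrl.test)) M.initialState
    (update (fun _ => []) M.k₁ (x.map eOut.symm)) [] [] (List.replicate n ())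

/-- **One iteration.** If `M` maps `x` to `y` within `m` steps (from `initList` to `haltList`),
then from `test` with value `x` and `n + 1` counter units the loop machine reaches `test` with
value `y` and `n` counter units within `2|x| + 3 + m` steps. [folklore] -/
theorem iterate_once {x y : List A} {m : ℕ} (n : ℕ)
    (h : ReachesIn M.step (initList M (x.map eIn.symm)) (haltList M (y.map eOut.symm)) m) :
    ReachesIn (C := LCfg M A) (iterTM M eIn eOut).step (cfgT M eOut x (n + 1)) (cfgT M eOut y n)
      (2 * x.length + 3 + m) := by
  obtain ⟨k, hk, e⟩ := h
  -- test: consume one counter unit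
  have h1 := ReachesIn.single (step_test_cons M eIn eOut M.initialState
    (update (fun _ => []) M.k₁ (x.map eOut.symm)) [] [] (List.replicate n ()) ())
  -- mv1: `k₁` to `TMP`
  have h2 := mv1_run M eIn eOut M.initialState (fun _ => []) (x.map eOut.symm) [] []
    (List.replicate n ())
  rw [update_eq_self] at h2
  have hx : (x.map eOut.symm).reverse.map eOut ++ [] = x.reverse := by
    simp [List.map_reverse]
  rw [hx, List.length_map] at h2
  -- mv2: `TMP` to `k₀`
  have h3 := mv2_run M eIn eOut M.initialState (fun _ => []) [] x.reverse (List.replicate n ())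
  rw [List.reverse_reverse, List.append_nil, List.length_reverse, ← cfgM_initList] at h3
  -- run `M`
  have h4 : ReachesIn (C := LCfg M A) (iterTM M eIn eOut).step (cfgM (initList M (x.map eIn.symm)) _)
      (cfgM (haltList M (y.map eOut.symm)) (List.replicate n ())) m :=
    ⟨k, hk, run_cfgM M eIn eOut e _⟩
  rw [cfgM_haltList] at h4
  have := ((h1.trans h2).trans h3).trans h4
  refine (this.mono ?_)
  omega

end Phases

end Bundled

/-! ### The loop machine computes the clocked iteration -/

section Main

/-- Evaluation of an `ℕ`-polynomial is monotone in the argument. [folklore] -/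
theorem eval_mono (p : Polynomial ℕ) {x y : ℕ} (hxy : x ≤ y) : p.eval x ≤ p.eval y := by
  induction p using Polynomial.induction_on' with
  | add p q hp hq => simp only [Polynomial.eval_add]; exact Nat.add_le_add hp hq
  | monomial n c =>
    simp only [Polynomial.eval_monomial]
    exact Nat.mul_le_mul_left c (Nat.pow_le_pow_left hxy n)

/-- `OutputsWithin` as a bounded run from `initList` to `haltList`. [folklore] -/
theorem reachesIn_of_outputsWithin {Γ₀ Γ₁ : Type} (N : TM2ComputableAux Γ₀ Γ₁) {l : List Γ₀}
    {l' : List Γ₁} {m : ℕ} (h : N.OutputsWithin l l' m) :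
    ReachesIn N.tm.step (initList N.tm (l.map N.inputAlphabet.symm))
      (haltList N.tm (l'.map N.outputAlphabet.symm)) m := by
  obtain ⟨⟨⟨n, hn⟩, hnm⟩⟩ := h
  exact ⟨n, hnm, hn⟩

/-- A bounded run from `initList` to `haltList` is `OutputsWithin`. [folklore] -/
theorem outputsWithin_of_reachesIn {Γ₀ Γ₁ : Type} (N : TM2ComputableAux Γ₀ Γ₁) {l : List Γ₀}
    {l' : List Γ₁} {m : ℕ} (h : ReachesIn N.tm.step (initList N.tm (l.map N.inputAlphabet.symm))
      (haltList N.tm (l'.map N.outputAlphabet.symm)) m) : N.OutputsWithin l l' m := by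
  obtain ⟨n, hnm, hn⟩ := h
  exact ⟨⟨⟨n, hn⟩, hnm⟩⟩

variable {α A : Type} [Inhabited A] {ea : α → List A} {F : α → α}
  (Mx : TM2ComputableAux A A) (p : Polynomial ℕ)
  (hF : ∀ a, Mx.OutputsWithin (ea a) (ea (F a)) (p.eval (ea a).length))

/-- The loop machine of `Mx : TM2ComputableAux A A`, as a machine with input alphabet
`Option A` and output alphabet `A`. [folklore] -/
noncomputable def iterAux : TM2ComputableAux (Option A) A :=
  ⟨iterTM Mx.tm Mx.inputAlphabet Mx.outputAlphabet, Equiv.refl _, Mx.outputAlphabet⟩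

include hF in
/-- **The main loop.** If all iterates `ea (F^[i] a₀)`, `i ≤ j + c`, have length `≤ B`, then
from `test` with value `ea (F^[j] a₀)` and `c` counter units the loop machine halts with output
`ea (F^[j + c] a₀)` within `c · (2B + 3 + p B) + 2` steps (`p` is monotone). [folklore] -/
theorem loop_run (a₀ : α) (B c : ℕ) : ∀ j : ℕ, (∀ i ≤ j + c, (ea (F^[i] a₀)).length ≤ B) →
    ReachesIn (C := LCfg Mx.tm A) (iterTM Mx.tm Mx.inputAlphabet Mx.outputAlphabet).step
      (cfgT Mx.tm Mx.outputAlphabet (ea (F^[j] a₀)) c)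
      (cfg Mx.tm A none Mx.tm.initialState
        (update (fun _ => []) Mx.tm.k₁ ((ea (F^[j + c] a₀)).map Mx.outputAlphabet.symm)) [] [] [])
      (c * (2 * B + 3 + p.eval B) + 2) := by
  induction c with
  | zero =>
    intro j _
    have h1 := ReachesIn.single (step_test_nil Mx.tm Mx.inputAlphabet Mx.outputAlphabet
      Mx.tm.initialState
      (update (fun _ => []) Mx.tm.k₁ ((ea (F^[j] a₀)).map Mx.outputAlphabet.symm)) [] [])
    have h2 := ReachesIn.single (step_fin Mx.tm Mx.inputAlphabet Mx.outputAlphabet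
      Mx.tm.initialState
      (update (fun _ => []) Mx.tm.k₁ ((ea (F^[j] a₀)).map Mx.outputAlphabet.symm)) [] [] [])
    simpa [cfgT] using h1.trans h2
  | succ c ih =>
    intro j hB
    have h1 := iterate_once Mx.tm Mx.inputAlphabet Mx.outputAlphabet c
      (reachesIn_of_outputsWithin Mx (hF (F^[j] a₀)))
    rw [← iterate_succ_apply' F j a₀] at h1
    have h2 := ih (j + 1) (fun i hi => hB i (by omega))
    rw [show j + 1 + c = j + (c + 1) by omega] at h2
    refine (h1.trans h2).mono ?_
    have hj : (ea (F^[j] a₀)).length ≤ B := hB j (by omega)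
    have hp := eval_mono p hj
    rw [add_one_mul]
    omega

/-- The running-time polynomial of the loop machine in terms of the time polynomial `p` of the
iterated machine and the size constant `d`: `2N + 4 + N · (2d N + 3 + p (d N))`. [folklore] -/
noncomputable def iterPoly (p : Polynomial ℕ) (d : ℕ) : Polynomial ℕ :=
  2 * Polynomial.X + 4 + Polynomial.X *
    (Polynomial.C (2 * d) * Polynomial.X + 3 + p.comp (Polynomial.C d * Polynomial.X))

/-- Evaluation of `iterPoly`. [folklore] -/
theorem iterPoly_eval (p : Polynomial ℕ) (d N : ℕ) :
    (iterPoly p d).eval N = 2 * N + 4 + N * (2 * d * N + 3 + p.eval (d * N)) := by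
  simp [iterPoly, Polynomial.eval_comp]

variable (d : ℕ) (hd : ∀ a n, (ea (F^[n] a)).length ≤ d * ((ea a).length + n))

include hd hF in
/-- **Correctness and running time of the loop machine.** On input
`replicate n none ++ (ea a).map some` the loop machine halts with output `ea (F^[n] a)` within
`(iterPoly p d).eval` of the input length, provided the iterates satisfy the size bound
`|ea (F^[i] a)| ≤ d (|ea a| + i)`. [folklore] -/
theorem iterAux_outputsWithin (a : α) (n : ℕ) :
    (iterAux Mx).OutputsWithin (List.replicate n none ++ (ea a).map some) (ea (F^[n] a))
      ((iterPoly p d).eval (List.replicate n none ++ (ea a).map some).length) := by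
  apply outputsWithin_of_reachesIn
  have hin : (List.replicate n none ++ (ea a).map some).map (iterAux Mx).inputAlphabet.symm =
      List.replicate n none ++ (ea a).map some := List.map_id _
  rw [hin]
  change ReachesIn (C := LCfg Mx.tm A) (iterTM Mx.tm Mx.inputAlphabet Mx.outputAlphabet).step
    (initList (iterTM Mx.tm Mx.inputAlphabet Mx.outputAlphabet) _)
    (haltList (iterTM Mx.tm Mx.inputAlphabet Mx.outputAlphabet)
      ((ea (F^[n] a)).map Mx.outputAlphabet.symm)) _
  rw [initList_iterTM, haltList_iterTM]
  -- init1 (counter), init1 (data), init2, then the main loop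
  have h1 := init1_cnt Mx.tm Mx.inputAlphabet Mx.outputAlphabet Mx.tm.initialState (fun _ => [])
    n ((ea a).map some) [] []
  have h2 := init1_data Mx.tm Mx.inputAlphabet Mx.outputAlphabet Mx.tm.initialState (fun _ => [])
    (ea a) [] [] (List.replicate n () ++ [])
  have h2' := ReachesIn.single (step_init1_nil Mx.tm Mx.inputAlphabet Mx.outputAlphabet
    Mx.tm.initialState (fun _ => []) ((ea a).reverse ++ []) (List.replicate n () ++ []))
  have h3 := init2_run Mx.tm Mx.inputAlphabet Mx.outputAlphabet Mx.tm.initialState (fun _ => [])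
    [] ((ea a).reverse ++ []) (List.replicate n () ++ [])
  simp only [List.append_nil, List.reverse_reverse, List.length_reverse] at h1 h2 h2' h3
  have h4 := loop_run Mx p hF a (d * ((ea a).length + n)) n 0 (fun i hi => (hd a i).trans
    (Nat.mul_le_mul_left d (by omega)))
  rw [iterate_zero_apply, Nat.zero_add] at h4
  have := (((h1.trans h2).trans h2').trans h3).trans h4
  refine this.mono ?_
  -- the polynomial bound, in terms of `N = |ea a| + n`
  rw [List.length_append, List.length_map, List.length_replicate, iterPoly_eval,
    Nat.add_comm n (ea a).length]
  set L := (ea a).length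
  have e1 : 2 * d * (L + n) = 2 * (d * (L + n)) := by ring
  have key : n * (2 * (d * (L + n)) + 3 + p.eval (d * (L + n))) ≤
      (L + n) * (2 * d * (L + n) + 3 + p.eval (d * (L + n))) :=
    Nat.mul_le_mul (Nat.le_add_left _ _) (by rw [e1])
  omega

/-- **Clocked iteration of a polynomial-time computable map is polynomial-time computable.**
If `F : α → α` is computed in polynomial time (w.r.t. an encoding `ea` over a nonempty
alphabet `A`) and the encoded iterates grow at most linearly,
`|ea (F^[n] a)| ≤ d (|ea a| + n)`, then `(a, n) ↦ F^[n] a` is computed in polynomial time on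
the input `replicate n none ++ (ea a).map some` (the iteration count in unary followed by the
encoding of `a`) — by the loop machine `iterTM`, which keeps the count on a separate stack and
re-feeds each output as the next input. This is the "time counter" device of the clocked
universal machine. [cite: AroraBarak2009, §1.4.1 (universal TM with time bound)] -/
theorem _root_.Literature.Computability.Complexity.PolyTimeComputable.iterate {α A : Type} [Inhabited A]
    {ea : α → List A} {F : α → α} (d : ℕ)
    (hd : ∀ a n, (ea (F^[n] a)).length ≤ d * ((ea a).length + n))
    (hF : PolyTimeComputable ea ea F) :
    PolyTimeComputable (fun q : α × ℕ => List.replicate q.2 none ++ (ea q.1).map some) ea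
      (fun q => F^[q.2] q.1) := by
  obtain ⟨p, Mx, h⟩ := hF
  exact ⟨iterPoly p d, iterAux Mx, fun q => iterAux_outputsWithin Mx p h d hd q.1 q.2⟩

/-- Additive growth per step, `|ea (F a)| ≤ |ea a| + d`, gives the linear bound on iterates
`|ea (F^[n] a)| ≤ (d + 1) (|ea a| + n)` used by `PolyTimeComputable.iterate`. [folklore] -/
theorem length_iterate_le_of_le_add {α A : Type} {ea : α → List A} {F : α → α} (d : ℕ)
    (hd : ∀ a, (ea (F a)).length ≤ (ea a).length + d) (a : α) (n : ℕ) :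
    (ea (F^[n] a)).length ≤ (d + 1) * ((ea a).length + n) := by
  have : (ea (F^[n] a)).length ≤ (ea a).length + d * n := by
    induction n with
    | zero => simp
    | succ n ih =>
      rw [iterate_succ_apply']
      have := hd (F^[n] a)
      rw [Nat.mul_succ]
      omega
  have e : (d + 1) * ((ea a).length + n) = d * (ea a).length + d * n + (ea a).length + n := by
    ring
  rw [e]
  omega

/-- **Clocked iteration, additive-growth form**: if `|ea (F a)| ≤ |ea a| + d` for all `a`
then `(a, n) ↦ F^[n] a` is polynomial-time computable on `replicate n none ++ (ea a).map some`.
[cite: AroraBarak2009, §1.4.1 (universal TM with time bound)] -/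
theorem _root_.Literature.Computability.Complexity.PolyTimeComputable.iterate_of_le_add {α A : Type} [Inhabited A]
    {ea : α → List A} {F : α → α} (d : ℕ) (hd : ∀ a, (ea (F a)).length ≤ (ea a).length + d)
    (hF : PolyTimeComputable ea ea F) :
    PolyTimeComputable (fun q : α × ℕ => List.replicate q.2 none ++ (ea q.1).map some) ea
      (fun q => F^[q.2] q.1) :=
  PolyTimeComputable.iterate (d + 1) (length_iterate_le_of_le_add d hd) hF

end Main

end TM2Iter

end Literature.Computability.Complexity
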